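import Summits.Ventures.CertifiedManyBodySolver.Downfold.EmeryFermiSurfaceShape
import HarnessLib

/-!
# The ORTHORHOMBIC σ three-band model: every constant-energy contour is EXACTLY an anisotropic
# `t_x–t_y–t′` one-band contour — the in-plane hopping anisotropy of the one-band image in closed form

Venture CertifiedManyBodySolver, cell `pub/hubbard-downfold` (stage S1; technique B = band level), seat hubbard-downfold-mod-4;
namespace `Summit.Ventures.CertifiedManyBodySolver.Downfold.Emery`. Sequel of `EmeryFermiSurfaceShape` (tetragonal contour theorem
`charCubic_eq_zero_iff_oneBandXY`: the σ-model Fermi surface is a `t–t′` Fermi surface, `t′/t = −fsN/(fsD + 2fsN)`).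

CONTEXT (cell bus 2026-08-27T15:31:15Z, lit-1: the SM tables of Vučičević et al. 2026 print, for the chain cuprates RE-123-O₇ / RE-124, a
ONE-band `t_x ≠ t_y` (YBa₂Cu₃O₇ −0.394 / −0.426 = 7.5 %, Y-124 5.3 %, Eu-123 12 %) — an INFL candidate for boxes bound with ONE square-lattice `t` —
and a THREE-band set with `ε_px ≠ ε_py`, `t_pdx ≠ t_pdy`, `t′_pxpx ≠ t′_pypy`). THE QUESTION for technique B: what anisotropy does the σ
three-band set itself imply for its one-band image? ANSWER (exact): with `Δ_x = ε_d − ε_px`, `Δ_y = ε_d − ε_py`, `t_x = t_pdx`, `t_y = t_pdy`,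
`c_x = t′_pxpx`, `c_y = t′_pypy` and the common `t_pp`, the secular cubic of the orthorhombic Bloch matrix `blochOrtho` is STILL BILINEAR in
`x = sin²(kx/2)`, `y = sin²(ky/2)` at fixed energy (`charCubicO_bilinear`): `charCubicO = oA − 4·oDx·x − 4·oDy·y − 16·oN·xy` with
`oA = ε(Δ_x + ε)(Δ_y + ε)`, `oDx = (Δ_y + ε)(t_x² − c_x ε)`, `oDy = (Δ_x + ε)(t_y² − c_y ε)`, `oN = ε(t_pp² − c_x c_y) + c_y t_x² + c_x t_y² + 2 t_x t_y t_pp`;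
hence (`charCubicO_eq_zero_iff_oneBandAnisoXY`, k-space `det_blochOrtho_eq_zero_iff_oneBandAniso`) every constant-energy contour is a level
set of the ANISOTROPIC nearest/next-nearest one-band form `c − 2t_X cos kx − 2t_Y cos ky − 4t′ cos kx cos ky` with
**`t_X = oDx + 2oN`, `t_Y = oDy + 2oN`, `t′ = −oN`** — so the one-band anisotropy of the σ model on the contour at `ε` is
`t_X/t_Y = (oDx + 2oN)/(oDy + 2oN)` and `t′/t_X = −oN/(oDx + 2oN)` in CLOSED FORM (`orthoTX`, `orthoTY`, `orthoTp`). The tetragonal case is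
recovered exactly (`oDx_sym`, `oDy_sym`, `oN_sym`, `charCubicO_sym`: `oDx = oDy = fsD`, `oN = fsN`, `charCubicO = charCubic`).
NUMBERS (SCREENING-GRADE, cell file router/INFLATION-RULES-3to1-B.md §B.26; script HOME/hubbard-downfold-mod-4/ortho/ortho_fs.py on the SM rows):
YBa₂Cu₃O₇ σ-implied `t_X/t_Y` = 0.924 (n = 1) / 0.927 (n = 0.84) vs the same-compound ONE-band (K) `t_x/t_y` = 0.925; Er-123 0.908 vs 0.896; Eu-123 0.901
vs 0.878; Y-124 0.971 vs 0.947; Eu-124 1.033 vs 1.105; HgBa₂CuO₄ (tetragonal control) 1.000 vs 1.000 — the 3 → 1 reduction TRANSFERS the in-plane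
anisotropy to 0.1–3 % (RE-123) / 2–7 % (RE-124). Everything here is PROVED (exact algebra; no material content); WHAT THIS IS NOT: a box rule (the
monotonicity/box companion of `EmeryFermiSurfaceShapeBox` is not repeated here) or a statement about chains (the CuO chain band is not in `blochOrtho`).
-/

noncomputable section

namespace Summit.Ventures.CertifiedManyBodySolver.Downfold.Emery

open Real Matrix

/-! ## §1 The orthorhombic Bloch matrix and its secular cubic -/

/-- **Orthorhombic σ three-band Bloch matrix** (basis `d, p_x, p_y`; gauge `ε_d = 0`): `Δ_x ≠ Δ_y` (O levels), `t_x ≠ t_y` (d–p hoppings),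
`c_x ≠ c_y` (across-Cu O–O hoppings), common `t_pp`; `sx = sin(kx/2)`, `sy = sin(ky/2)`.
[cite: HybertsenSchluterChristensen1989, Eq. (1) (three-band d–p model; here with orthorhombic entries)] -/
def blochOrtho (Δx Δy tx ty tpp cx cy sx sy : ℝ) : Matrix (Fin 3) (Fin 3) ℝ :=
  !![0, 2 * tx * sx, -2 * ty * sy;
     2 * tx * sx, -Δx - 4 * cx * sx ^ 2, -4 * tpp * sx * sy;
     -2 * ty * sy, -4 * tpp * sx * sy, -Δy - 4 * cy * sy ^ 2]

/-- The tetragonal matrix is the special case `Δ_x = Δ_y`, `t_x = t_y`, `c_x = c_y`. [folklore] -/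
theorem blochOrtho_sym (Δ tpd tpp c sx sy : ℝ) : blochOrtho Δ Δ tpd tpd tpp c c sx sy = bloch4 Δ tpd tpp c sx sy := by
  ext i j
  fin_cases i <;> fin_cases j <;> simp [blochOrtho, bloch4]

/-- Minus the characteristic determinant of `blochOrtho` as a function of `x = sx²`, `y = sy²`, `ε`:
`ε[(Δ_x + 4c_x x + ε)(Δ_y + 4c_y y + ε) − 16t_pp²xy] − 4t_x²x(Δ_y + 4c_y y + ε) − 4t_y²y(Δ_x + 4c_x x + ε) − 32 t_x t_y t_pp xy`. [folklore] -/
def charCubicO (Δx Δy tx ty tpp cx cy x y ε : ℝ) : ℝ :=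
  ε * ((Δx + 4 * cx * x + ε) * (Δy + 4 * cy * y + ε) - 16 * tpp ^ 2 * x * y)
    - 4 * tx ^ 2 * x * (Δy + 4 * cy * y + ε) - 4 * ty ^ 2 * y * (Δx + 4 * cx * x + ε)
    - 32 * tx * ty * tpp * x * y

/-- `det(blochOrtho − ε·1) = −charCubicO(sx², sy², ε)`. [folklore] -/
theorem det_blochOrtho_sub_eq_neg_charCubicO (Δx Δy tx ty tpp cx cy sx sy ε : ℝ) :
    (blochOrtho Δx Δy tx ty tpp cx cy sx sy - ε • (1 : Matrix (Fin 3) (Fin 3) ℝ)).det =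
      -charCubicO Δx Δy tx ty tpp cx cy (sx ^ 2) (sy ^ 2) ε := by
  simp [blochOrtho, Matrix.det_fin_three, Matrix.sub_apply, Matrix.smul_apply]
  unfold charCubicO
  ring

/-- The tetragonal secular cubic is recovered. [folklore] -/
theorem charCubicO_sym (Δ tpd tpp c x y ε : ℝ) : charCubicO Δ Δ tpd tpd tpp c c x y ε = charCubic Δ tpd tpp c x y ε := by
  unfold charCubicO charCubic
  ring

/-! ## §2 Bilinearity in `(x, y)` with orthorhombic coefficients -/

/-- `oA(ε) = ε(Δ_x + ε)(Δ_y + ε)` (value at Γ). [folklore] -/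
def oA (Δx Δy ε : ℝ) : ℝ := ε * (Δx + ε) * (Δy + ε)

/-- `x`-direction nearest-neighbour weight `oDx = (Δ_y + ε)(t_x² − c_x ε)`. [folklore] -/
def oDx (Δy tx cx ε : ℝ) : ℝ := (Δy + ε) * (tx ^ 2 - cx * ε)

/-- `y`-direction nearest-neighbour weight `oDy = (Δ_x + ε)(t_y² − c_y ε)`. [folklore] -/
def oDy (Δx ty cy ε : ℝ) : ℝ := (Δx + ε) * (ty ^ 2 - cy * ε)

/-- Diagonal weight `oN = ε(t_pp² − c_x c_y) + c_y t_x² + c_x t_y² + 2 t_x t_y t_pp`. [folklore] -/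
def oN (tx ty tpp cx cy ε : ℝ) : ℝ := ε * (tpp ^ 2 - cx * cy) + cy * tx ^ 2 + cx * ty ^ 2 + 2 * tx * ty * tpp

/-- BILINEARITY: `charCubicO = oA − 4·oDx·x − 4·oDy·y − 16·oN·xy` — no `x²` or `y²` term, orthorhombic or not.
[cite: AndersenEtAl1995, §6] -/
theorem charCubicO_bilinear (Δx Δy tx ty tpp cx cy x y ε : ℝ) :
    charCubicO Δx Δy tx ty tpp cx cy x y ε =
      oA Δx Δy ε - 4 * oDx Δy tx cx ε * x - 4 * oDy Δx ty cy ε * y - 16 * oN tx ty tpp cx cy ε * (x * y) := by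
  unfold charCubicO oA oDx oDy oN
  ring

/-- Tetragonal reduction of the coefficients: `oDx = fsD`. [folklore] -/
theorem oDx_sym (Δ tpd c ε : ℝ) : oDx Δ tpd c ε = fsD Δ tpd c ε := by unfold oDx fsD; ring

/-- Tetragonal reduction: `oDy = fsD`. [folklore] -/
theorem oDy_sym (Δ tpd c ε : ℝ) : oDy Δ tpd c ε = fsD Δ tpd c ε := by unfold oDy fsD; ring

/-- Tetragonal reduction: `oN = fsN`. [folklore] -/
theorem oN_sym (tpd tpp c ε : ℝ) : oN tpd tpd tpp c c ε = fsN tpd tpp c ε := by unfold oN fsN; ring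

/-! ## §3 The anisotropic one-band form and the contour theorem -/

/-- The ANISOTROPIC nearest/next-nearest one-band dispersion `c − 2t_X cos kx − 2t_Y cos ky − 4t′ cos kx cos ky`. [folklore] -/
def oneBandAniso (c tX tY t' kx ky : ℝ) : ℝ :=
  c - 2 * tX * Real.cos kx - 2 * tY * Real.cos ky - 4 * t' * (Real.cos kx * Real.cos ky)

/-- The same in the half-angle variables `x = sin²(kx/2)`, `y = sin²(ky/2)`. [folklore] -/
def oneBandAnisoXY (c tX tY t' x y : ℝ) : ℝ :=
  c - 2 * tX * (1 - 2 * x) - 2 * tY * (1 - 2 * y) - 4 * t' * ((1 - 2 * x) * (1 - 2 * y))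

/-- `oneBandAniso = oneBandAnisoXY` at `x = sin²(kx/2)`, `y = sin²(ky/2)`. [folklore] -/
theorem oneBandAniso_eq_XY (c tX tY t' kx ky : ℝ) :
    oneBandAniso c tX tY t' kx ky = oneBandAnisoXY c tX tY t' (Real.sin (kx / 2) ^ 2) (Real.sin (ky / 2) ^ 2) := by
  unfold oneBandAniso oneBandAnisoXY
  rw [Literature.Probability.LatticeModels.cos_eq_one_sub_two_mul_sin_half_sq kx,
    Literature.Probability.LatticeModels.cos_eq_one_sub_two_mul_sin_half_sq ky]

/-- With `t_X = t_Y` it is the pure `t–t′` form (`t″ = 0`). [folklore] -/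
theorem oneBandAniso_sym (c t t' kx ky : ℝ) : oneBandAniso c t t t' kx ky = oneBand c t t' 0 kx ky := by
  unfold oneBandAniso oneBand; ring

/-- The contour hoppings of the orthorhombic σ model at energy `ε` (conventional common scale): `t_X = oDx + 2oN`. [folklore] -/
def orthoTX (Δy tx ty tpp cx cy ε : ℝ) : ℝ := oDx Δy tx cx ε + 2 * oN tx ty tpp cx cy ε

/-- `t_Y = oDy + 2oN`. [folklore] -/
def orthoTY (Δx tx ty tpp cx cy ε : ℝ) : ℝ := oDy Δx ty cy ε + 2 * oN tx ty tpp cx cy ε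

/-- `t′ = −oN`. [folklore] -/
def orthoTp (tx ty tpp cx cy ε : ℝ) : ℝ := -oN tx ty tpp cx cy ε

/-- The secular cubic IS (minus) an anisotropic one-band form up to an additive constant:
`charCubicO = oA − [oneBandAnisoXY γ t_X t_Y t′ − (γ − 2t_X − 2t_Y − 4t′)]`. [folklore] -/
theorem charCubicO_eq_oneBandAnisoXY (Δx Δy tx ty tpp cx cy x y ε γ : ℝ) :
    charCubicO Δx Δy tx ty tpp cx cy x y ε =
      oA Δx Δy ε - (oneBandAnisoXY γ (orthoTX Δy tx ty tpp cx cy ε) (orthoTY Δx tx ty tpp cx cy ε) (orthoTp tx ty tpp cx cy ε) x y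
        - (γ - 2 * orthoTX Δy tx ty tpp cx cy ε - 2 * orthoTY Δx tx ty tpp cx cy ε - 4 * orthoTp tx ty tpp cx cy ε)) := by
  rw [charCubicO_bilinear]
  unfold oneBandAnisoXY orthoTX orthoTY orthoTp
  ring

/-- **THE ORTHORHOMBIC CONTOUR THEOREM in `(x, y)`**: `charCubicO(x, y, ε) = 0` iff `(x, y)` lies on the level set
`oneBandAnisoXY γ t_X t_Y t′ = γ − 2t_X − 2t_Y − 4t′ + oA(ε)` of the anisotropic one-band form with `t_X = oDx + 2oN`, `t_Y = oDy + 2oN`,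
`t′ = −oN`. [cite: AndersenEtAl1995, §6] -/
theorem charCubicO_eq_zero_iff_oneBandAnisoXY (Δx Δy tx ty tpp cx cy x y ε γ : ℝ) :
    charCubicO Δx Δy tx ty tpp cx cy x y ε = 0 ↔
      oneBandAnisoXY γ (orthoTX Δy tx ty tpp cx cy ε) (orthoTY Δx tx ty tpp cx cy ε) (orthoTp tx ty tpp cx cy ε) x y
        = γ - 2 * orthoTX Δy tx ty tpp cx cy ε - 2 * orthoTY Δx tx ty tpp cx cy ε - 4 * orthoTp tx ty tpp cx cy ε + oA Δx Δy ε := by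
  rw [charCubicO_eq_oneBandAnisoXY Δx Δy tx ty tpp cx cy x y ε γ]
  constructor <;> intro h <;> linarith

/-- **THE ORTHORHOMBIC CONTOUR THEOREM in k-space**: `ε` is a band energy of `blochOrtho` at `k` iff `k` lies on a constant-energy contour of
the anisotropic one-band dispersion `oneBandAniso γ t_X(ε) t_Y(ε) t′(ε)` — the one-band IMAGE of an orthorhombic σ three-band set has
`t_X/t_Y = (oDx + 2oN)/(oDy + 2oN)` and `t′/t_X = −oN/(oDx + 2oN)` exactly on each contour. [cite: AndersenEtAl1995, §6] -/
theorem det_blochOrtho_eq_zero_iff_oneBandAniso (Δx Δy tx ty tpp cx cy kx ky ε γ : ℝ) :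
    (blochOrtho Δx Δy tx ty tpp cx cy (Real.sin (kx / 2)) (Real.sin (ky / 2)) - ε • (1 : Matrix (Fin 3) (Fin 3) ℝ)).det = 0 ↔
      oneBandAniso γ (orthoTX Δy tx ty tpp cx cy ε) (orthoTY Δx tx ty tpp cx cy ε) (orthoTp tx ty tpp cx cy ε) kx ky
        = γ - 2 * orthoTX Δy tx ty tpp cx cy ε - 2 * orthoTY Δx tx ty tpp cx cy ε - 4 * orthoTp tx ty tpp cx cy ε + oA Δx Δy ε := by
  rw [det_blochOrtho_sub_eq_neg_charCubicO, neg_eq_zero, oneBandAniso_eq_XY]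
  exact charCubicO_eq_zero_iff_oneBandAnisoXY _ _ _ _ _ _ _ _ _ _ _

/-! ## §4 The anisotropy in closed form and its tetragonal limit -/

/-- **The in-plane hopping anisotropy of the one-band image**: `t_X − t_Y = oDx − oDy` (the diagonal weight cancels), i.e.
`t_X − t_Y = (Δ_y + ε)(t_x² − c_x ε) − (Δ_x + ε)(t_y² − c_y ε)`. [folklore] -/
theorem orthoTX_sub_orthoTY (Δx Δy tx ty tpp cx cy ε : ℝ) :
    orthoTX Δy tx ty tpp cx cy ε - orthoTY Δx tx ty tpp cx cy ε = (Δy + ε) * (tx ^ 2 - cx * ε) - (Δx + ε) * (ty ^ 2 - cy * ε) := by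
  unfold orthoTX orthoTY oDx oDy; ring

/-- With equal O levels and across-Cu hoppings (`Δ_x = Δ_y`, `c_x = c_y`) the anisotropy is carried by `t_x² − t_y²` alone:
`t_X − t_Y = (Δ + ε)(t_x² − t_y²)`. [folklore] -/
theorem orthoTX_sub_orthoTY_of_levels_eq (Δ tx ty tpp c ε : ℝ) :
    orthoTX Δ tx ty tpp c c ε - orthoTY Δ tx ty tpp c c ε = (Δ + ε) * (tx ^ 2 - ty ^ 2) := by
  rw [orthoTX_sub_orthoTY]; ring

/-- Tetragonal limit: `t_X = t_Y = fsT` and `t′ = fsTp` (the contour hoppings of `EmeryFermiSurfaceShape`). [folklore] -/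
theorem orthoT_sym (Δ tpd tpp c ε : ℝ) :
    orthoTX Δ tpd tpd tpp c c ε = fsT Δ tpd tpp c ε ∧ orthoTY Δ tpd tpd tpp c c ε = fsT Δ tpd tpp c ε ∧
      orthoTp tpd tpd tpp c c ε = fsTp tpd tpp c ε := by
  refine ⟨?_, ?_, ?_⟩
  · unfold orthoTX fsT; rw [oDx_sym, oN_sym]
  · unfold orthoTY fsT; rw [oDy_sym, oN_sym]
  · unfold orthoTp fsTp; rw [oN_sym]

/-- SCALE COVARIANCE: multiplying every σ energy `(Δ_x, Δ_y, t_x, t_y, t_pp, c_x, c_y, ε)` by `λ` multiplies `charCubicO` by `λ³` — contours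
(hence `t_X/t_Y` and `t′/t_X`) are invariant under a common rescaling. [folklore] -/
theorem charCubicO_smul (l Δx Δy tx ty tpp cx cy x y ε : ℝ) :
    charCubicO (l * Δx) (l * Δy) (l * tx) (l * ty) (l * tpp) (l * cx) (l * cy) x y (l * ε) =
      l ^ 3 * charCubicO Δx Δy tx ty tpp cx cy x y ε := by
  unfold charCubicO; ring

end Summit.Ventures.CertifiedManyBodySolver.Downfold.Emery

end
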